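import Mathlib
import Literature.NumberTheory.Sieve.Maynard2016I1Expand
import HarnessLib

/-!
# Maynard (2016), Lemma 7: the Fubini expansion of `J_k^{(1),i}(F)` and `J_k^{(2)}(G)`

J. Maynard, *Large gaps between primes*, Ann. of Math. (2) 183 (2016), 915–933 = arXiv:1408.5110,
§6, Lemma 7 (definition of `J_k^{(1)}, J_k^{(2)}` and the last step of its proof, display (6.33)).
For sieve data `F = Σ_j c_j ∏_ℓ F'_{ℓ,j}` (display (5.5)):

* `IsSieveData.integral_Ioi_deriv_Fd` — `∫_0^∞ F'_{ℓ,j} = −F_{ℓ,j}(0)`;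
* `IsSieveData.J1_eq_sum` —
  `J_k^{(1),i}(F) = Σ_j Σ_{j'} c_j c_{j'} F_{i,j}(0) F_{i,j'}(0) ∏_{ℓ ≠ i} ∫_0^∞ F'_{ℓ,j} F'_{ℓ,j'}`,
  and the same with the product over the subtype `{ℓ // ℓ ≠ i}` (`J1_eq_sum_subtype`);
* `J2_eq_prod_subtype` — `J_k^{(2)}(G) = G(0)² ∏_{ℓ ≠ i} ∫_0^∞ G' G'`.

These match the pair constants of the `(k−1)`-slot engine of Lemma 7 (`Maynard2016Lemma7MainSum`).

## References

* J. Maynard, *Large gaps between primes*, Ann. of Math. (2) 183 (2016), 915–933; arXiv:1408.5110,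
  §6, Lemma 7. [Maynard2016LargeGaps]
-/

noncomputable section

open Filter Finset Real MeasureTheory Set
open scoped BigOperators Topology

namespace Literature.NumberTheory.Sieve

namespace Maynard2016

variable {k J : ℕ} {c : Fin J → ℝ} {Fd : Fin k → Fin J → ℝ → ℝ} {G : ℝ → ℝ}

/-! ### One-variable facts -/

/-- `F'_{ℓ,j}` is integrable on `(0, ∞)` (continuous, vanishing on `(1/10, ∞)`).
[cite: Maynard2016LargeGaps, §5 display (5.4)] -/
theorem IsSieveData.integrableOn_deriv_Fd (h : IsSieveData k J c Fd G) (ℓ : Fin k) (j : Fin J) :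
    IntegrableOn (deriv (Fd ℓ j)) (Ioi (0 : ℝ)) := by
  have hcont : Continuous (deriv (Fd ℓ j)) := (h.Fd_smooth ℓ j).continuous_deriv (by simp)
  have h1 : IntegrableOn (deriv (Fd ℓ j)) (Icc (0 : ℝ) (1 / 10)) :=
    hcont.continuousOn.integrableOn_compact isCompact_Icc
  have h2 : IntegrableOn (deriv (Fd ℓ j)) (Ioi (1 / 10 : ℝ)) := by
    refine integrableOn_zero.congr_fun (fun t ht => ?_) measurableSet_Ioi
    exact ((h.isSieveCutoff_Fd ℓ j).deriv_eq_zero (Set.mem_Ioi.1 ht)).symm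
  refine (h1.union h2).mono_set fun t ht => ?_
  rcases le_or_gt t (1 / 10) with h' | h'
  · exact Or.inl ⟨(Set.mem_Ioi.1 ht).le, h'⟩
  · exact Or.inr h'

/-- **`∫_0^∞ F'_{ℓ,j}(u) du = −F_{ℓ,j}(0)`** (fundamental theorem of calculus; `F_{ℓ,j}` vanishes on
`(1/10, ∞)`). [cite: Maynard2016LargeGaps, Lemma 7 (proof, display (6.33))] -/
theorem IsSieveData.integral_Ioi_deriv_Fd (h : IsSieveData k J c Fd G) (ℓ : Fin k) (j : Fin J) :
    ∫ u in Ioi (0 : ℝ), deriv (Fd ℓ j) u = -Fd ℓ j 0 := by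
  have hdiff : Differentiable ℝ (Fd ℓ j) := (h.Fd_smooth ℓ j).differentiable (by simp)
  have hlim : Tendsto (Fd ℓ j) atTop (𝓝 0) := by
    refine tendsto_const_nhds.congr' ?_
    filter_upwards [eventually_gt_atTop (1 / 10 : ℝ)] with u hu
    exact (h.Fd_eq_zero ℓ j hu).symm
  rw [integral_Ioi_of_hasDerivAt_of_tendsto hdiff.continuous.continuousWithinAt
    (fun u _ => (hdiff u).hasDerivAt) (h.integrableOn_deriv_Fd ℓ j) hlim]
  ring

/-- The one-variable factors `1_{[0,∞)} F'_{ℓ,j} F'_{ℓ,j'}` are integrable.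
[cite: Maynard2016LargeGaps, §6 display (6.20)] -/
private theorem j1_integrable_indicator_deriv_mul (h : IsSieveData k J c Fd G) (ℓ : Fin k)
    (j j' : Fin J) :
    Integrable ((Ici (0 : ℝ)).indicator fun t => deriv (Fd ℓ j) t * deriv (Fd ℓ j') t) := by
  have hcont : Continuous fun t => deriv (Fd ℓ j) t * deriv (Fd ℓ j') t :=
    ((h.Fd_smooth ℓ j).continuous_deriv (by simp)).mul ((h.Fd_smooth ℓ j').continuous_deriv (by simp))
  have heq : (Ici (0 : ℝ)).indicator (fun t => deriv (Fd ℓ j) t * deriv (Fd ℓ j') t) =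
      (Icc (0 : ℝ) (1 / 10)).indicator fun t => deriv (Fd ℓ j) t * deriv (Fd ℓ j') t := by
    funext t
    by_cases ht : t ∈ Icc (0 : ℝ) (1 / 10)
    · rw [indicator_of_mem ht, indicator_of_mem (Set.mem_Ici.2 ht.1)]
    · rw [indicator_of_notMem ht]
      by_cases h0 : 0 ≤ t
      · rw [indicator_of_mem (Set.mem_Ici.2 h0)]
        have h1 : 1 / 10 < t := by
          by_contra h1; exact ht ⟨h0, not_lt.1 h1⟩
        rw [(h.isSieveCutoff_Fd ℓ j).deriv_eq_zero h1, zero_mul]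
      · rw [indicator_of_notMem (fun h' => h0 (Set.mem_Ici.1 h'))]
  rw [heq, integrable_indicator_iff measurableSet_Icc]
  exact hcont.continuousOn.integrableOn_compact isCompact_Icc

/-- The inner integral of `J_k^{(1),i}`: for every `t`,
`∫_0^∞ F(t with t_i := u) du = Σ_j c_j (−F_{i,j}(0)) ∏_{ℓ ≠ i} F'_{ℓ,j}(t_ℓ)`.
[cite: Maynard2016LargeGaps, Lemma 7 (proof, display (6.33))] -/
theorem IsSieveData.integral_Fsum_update (h : IsSieveData k J c Fd G) (i : Fin k) (t : Fin k → ℝ) :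
    ∫ u in Ioi (0 : ℝ), Fsum c Fd (Function.update t i u) =
      ∑ j, c j * (-Fd i j 0) * ∏ ℓ ∈ univ.erase i, deriv (Fd ℓ j) (t ℓ) := by
  classical
  -- pointwise: split off the slot `i`
  have hpt : ∀ u : ℝ, Fsum c Fd (Function.update t i u) =
      ∑ j, (c j * ∏ ℓ ∈ univ.erase i, deriv (Fd ℓ j) (t ℓ)) * deriv (Fd i j) u := by
    intro u
    unfold Fsum
    refine Finset.sum_congr rfl fun j _ => ?_
    rw [← Finset.mul_prod_erase univ (fun ℓ => deriv (Fd ℓ j) (Function.update t i u ℓ))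
      (Finset.mem_univ i), Function.update_self]
    have : ∏ ℓ ∈ univ.erase i, deriv (Fd ℓ j) (Function.update t i u ℓ) =
        ∏ ℓ ∈ univ.erase i, deriv (Fd ℓ j) (t ℓ) :=
      Finset.prod_congr rfl fun ℓ hℓ => by rw [Function.update_of_ne (Finset.mem_erase.1 hℓ).1]
    rw [this]; ring
  simp_rw [hpt]
  rw [integral_finsetSum _ fun j _ => ((h.integrableOn_deriv_Fd i j).const_mul _)]
  refine Finset.sum_congr rfl fun j _ => ?_
  rw [integral_const_mul, h.integral_Ioi_deriv_Fd i j]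
  ring

/-! ### The Fubini expansion of `J_k^{(1),i}(F)` -/

/-- **`J_k^{(1),i}(F) = Σ_j Σ_{j'} c_j c_{j'} F_{i,j}(0) F_{i,j'}(0) ∏_{ℓ ≠ i} ∫_0^∞ F'_{ℓ,j} F'_{ℓ,j'}`**
(the inner integral by `integral_Fsum_update`, then expanding the square and Fubini; the dummy
variable `t_i ∈ [0,1]` contributes the factor `1`). [cite: Maynard2016LargeGaps, Lemma 7 (proof, display (6.33))] -/
theorem IsSieveData.J1_eq_sum (h : IsSieveData k J c Fd G) (i : Fin k) :
    J1 c Fd i = ∑ j, ∑ j', c j * c j' * (Fd i j 0 * Fd i j' 0 *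
      ∏ ℓ ∈ univ.erase i, ∫ t in Ioi (0 : ℝ), deriv (Fd ℓ j) t * deriv (Fd ℓ j') t) := by
  classical
  -- the one-variable factors: `1_{[0,1]}` in the slot `i`, `1_{[0,∞)} F'_{ℓ,j} F'_{ℓ,j'}` elsewhere
  set g : Fin J → Fin J → Fin k → ℝ → ℝ := fun j j' ℓ =>
    if ℓ = i then (Icc (0 : ℝ) 1).indicator (fun _ => (1 : ℝ))
    else (Ici (0 : ℝ)).indicator fun t => deriv (Fd ℓ j) t * deriv (Fd ℓ j') t with hg
  have hgi : ∀ j j' ℓ, Integrable (g j j' ℓ) := by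
    intro j j' ℓ
    by_cases hℓ : ℓ = i
    · simp only [hg, hℓ, if_true]
      rw [integrable_indicator_iff measurableSet_Icc]
      exact integrableOn_const (by rw [Real.volume_Icc]; exact ENNReal.ofReal_ne_top)
    · simp only [hg, hℓ, if_false]
      exact j1_integrable_indicator_deriv_mul h ℓ j j'
  -- the domain and the expanded integrand
  set S : Set (Fin k → ℝ) := Set.univ.pi fun ℓ : Fin k => if ℓ = i then Icc (0 : ℝ) 1 else Ici 0
    with hSdef
  have hS : MeasurableSet S := by
    refine MeasurableSet.univ_pi fun ℓ => ?_
    by_cases hℓ : ℓ = i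
    · simp only [hℓ, if_true]; exact measurableSet_Icc
    · simp only [hℓ, if_false]; exact measurableSet_Ici
  have hpt : S.indicator (fun t => (∫ u in Ioi (0 : ℝ), Fsum c Fd (Function.update t i u)) ^ 2) =
      fun t => ∑ j, ∑ j', c j * c j' * (Fd i j 0 * Fd i j' 0) * ∏ ℓ, g j j' ℓ (t ℓ) := by
    funext t
    by_cases ht : t ∈ S
    · rw [indicator_of_mem ht, h.integral_Fsum_update i t, sq, Finset.sum_mul_sum]
      refine Finset.sum_congr rfl fun j _ => Finset.sum_congr rfl fun j' _ => ?_
      have hin : ∀ ℓ, g j j' ℓ (t ℓ) =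
          if ℓ = i then 1 else deriv (Fd ℓ j) (t ℓ) * deriv (Fd ℓ j') (t ℓ) := by
        intro ℓ
        have htℓ := ht ℓ (Set.mem_univ ℓ)
        by_cases hℓ : ℓ = i
        · simp only [hg, hℓ, if_true] at htℓ ⊢
          rw [indicator_of_mem htℓ]
        · simp only [hg, hℓ, if_false] at htℓ ⊢
          rw [indicator_of_mem htℓ]
      simp_rw [hin]
      rw [← Finset.mul_prod_erase univ _ (Finset.mem_univ i)]
      simp only [if_true, one_mul]
      have hrest : ∏ ℓ ∈ univ.erase i,
          (if ℓ = i then (1 : ℝ) else deriv (Fd ℓ j) (t ℓ) * deriv (Fd ℓ j') (t ℓ)) =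
          (∏ ℓ ∈ univ.erase i, deriv (Fd ℓ j) (t ℓ)) * ∏ ℓ ∈ univ.erase i, deriv (Fd ℓ j') (t ℓ) := by
        rw [← Finset.prod_mul_distrib]
        exact Finset.prod_congr rfl fun ℓ hℓ => by rw [if_neg (Finset.mem_erase.1 hℓ).1]
      rw [hrest]; ring
    · rw [indicator_of_notMem ht]
      have ht' : ∃ ℓ₀, t ℓ₀ ∉ (if ℓ₀ = i then Icc (0 : ℝ) 1 else Ici 0) := by
        by_contra hcon
        push Not at hcon
        exact ht fun ℓ _ => hcon ℓ
      obtain ⟨ℓ₀, hℓ₀⟩ := ht'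
      symm
      refine Finset.sum_eq_zero fun j _ => Finset.sum_eq_zero fun j' _ => ?_
      have hz : g j j' ℓ₀ (t ℓ₀) = 0 := by
        by_cases hℓ : ℓ₀ = i
        · simp only [hg, hℓ, if_true] at hℓ₀ ⊢; rw [indicator_of_notMem hℓ₀]
        · simp only [hg, hℓ, if_false] at hℓ₀ ⊢; rw [indicator_of_notMem hℓ₀]
      rw [Finset.prod_eq_zero (Finset.mem_univ ℓ₀) hz, mul_zero]
  rw [J1, ← hSdef, ← integral_indicator hS, hpt]
  -- interchange sums and integral; Fubini on each term
  have hterm : ∀ j j', Integrable fun t : Fin k → ℝ =>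
      c j * c j' * (Fd i j 0 * Fd i j' 0) * ∏ ℓ, g j j' ℓ (t ℓ) :=
    fun j j' => (Integrable.fintype_prod (f := g j j') (hgi j j')).const_mul _
  rw [integral_finsetSum _ fun j _ => integrable_finsetSum _ fun j' _ => hterm j j']
  refine Finset.sum_congr rfl fun j _ => ?_
  rw [integral_finsetSum _ fun j' _ => hterm j j']
  refine Finset.sum_congr rfl fun j' _ => ?_
  rw [integral_const_mul, integral_fintype_prod_volume_eq_prod, mul_assoc]
  congr 2
  rw [← Finset.mul_prod_erase univ _ (Finset.mem_univ i)]
  have hi : ∫ s, g j j' i s = 1 := by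
    simp only [hg, if_true]
    rw [integral_indicator measurableSet_Icc, setIntegral_const, Measure.real, Real.volume_Icc,
      smul_eq_mul, mul_one]
    norm_num
  rw [hi, one_mul]
  refine Finset.prod_congr rfl fun ℓ hℓ => ?_
  have hne : ℓ ≠ i := (Finset.mem_erase.1 hℓ).1
  simp only [hg, hne, if_false]
  rw [integral_indicator measurableSet_Ici, integral_Ici_eq_integral_Ioi]

/-- `J_k^{(1),i}(F)` with the product over the subtype of slots `ℓ ≠ i` (the index type of the
`(k−1)`-slot engine of Lemma 7). [cite: Maynard2016LargeGaps, Lemma 7 (proof, display (6.33))] -/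
theorem IsSieveData.J1_eq_sum_subtype (h : IsSieveData k J c Fd G) (i : Fin k) :
    J1 c Fd i = ∑ j, ∑ j', c j * c j' * (Fd i j 0 * Fd i j' 0 *
      ∏ l : {l : Fin k // l ≠ i}, ∫ t in Ioi (0 : ℝ), deriv (Fd l.1 j) t * deriv (Fd l.1 j') t) := by
  rw [h.J1_eq_sum i]
  refine Finset.sum_congr rfl fun j _ => Finset.sum_congr rfl fun j' _ => ?_
  congr 2
  exact Finset.prod_subtype (univ.erase i) (fun l => by simp [Finset.mem_erase]) _

/-- `J_k^{(2)}(G) = G(0)² ∏_{ℓ ≠ i} ∫_0^∞ G'(t) G'(t) dt` (product over the `k − 1` slots `ℓ ≠ i`).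
[cite: Maynard2016LargeGaps, Lemma 7 (proof, display (6.33))] -/
theorem J2_eq_prod_subtype (k : ℕ) (G : ℝ → ℝ) (i : Fin k) :
    J2 k G = G 0 ^ 2 * ∏ _l : {l : Fin k // l ≠ i}, ∫ t in Ioi (0 : ℝ), deriv G t * deriv G t := by
  rw [J2, Finset.prod_const, Finset.card_univ]
  have hcard : Fintype.card {l : Fin k // l ≠ i} = k - 1 := by
    rw [Fintype.card_subtype, Finset.filter_ne', Finset.card_erase_of_mem (Finset.mem_univ i),
      Finset.card_univ, Fintype.card_fin]
  rw [hcard]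
  congr 2
  refine integral_congr_ae (Eventually.of_forall fun t => ?_)
  beta_reduce
  rw [sq]

end Maynard2016

end Literature.NumberTheory.Sieve

end
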